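import Literature.Combinatorics.Enumerative.HafnianExpansion
import Literature.LinearAlgebra.Matrix.PfaffianDeterminant
import Mathlib.LinearAlgebra.Matrix.Determinant.Basic
import Mathlib.LinearAlgebra.Matrix.Notation
import Mathlib.Order.Interval.Finset.Fin
import Mathlib.Data.Fintype.Sort
import HarnessLib

/-!
# The Pfaffian: signed perfect-matching sum and its row expansion

Topic `Literature/Combinatorics/Enumerative`, companion of `Hafnian.lean` / `HafnianExpansion.lean`
(same vertex set `W`, same `perfectMatchings W` — fixed-point-free involutions — and the same
matched-entry product `∏_{v < τ v} A v (τ v)`; the Pfaffian inserts the sign of the matching) and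
of the tree's Pfaffian files `Literature/LinearAlgebra/Matrix/Pfaffian.lean` (the Pfaffian
`Literature.LinearAlgebra.Matrix.pfaffian` on `Fin n`, DEFINED by Kustin–Ulrich's Laplace expansion
along the first row), `PfaffianRows`, `PfaffianTransvection`, `PfaffianDeterminant` (Cayley's
theorem), `PfaffianCharpoly`, `PfaffianCongruence`: this file is the PERFECT-MATCHING form, proved
equal to the tree's Pfaffian on `Fin n` (`pfaffian_eq_matrixPfaffian`, v2).

For a matrix `A` indexed by a finite linearly ordered type `W` the **Pfaffian** is

  `pf A = Σ_{M perfect matching of K_W} sgn(M) · ∏_{{u,v} ∈ M, u < v} A u v`,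

"`f[x_1 … x_{2n}] = Σ s(x_1…x_{2n}, y_1…y_{2n}) f[y_1y_2] ⋯ f[y_{2n−1}y_{2n}]` (0.1), where the sum
is over all `(2n−1)(2n−3)⋯(1)` ways to write the set `{x_1,…,x_{2n}}` as a union of pairs … and
where the coefficient `s` is the sign of the permutation that takes `x_1…x_{2n}` into `y_1…y_{2n}`"
[cite: Knuth1996Pfaffians, §0 eq. (0.1)]; "define the weight of `π` … to be
`sign(α) ∏_{i=1}^{m} a_{(2i−1)α,(2i)α}` … `pf A := Σ_π wt(π)`, where the sum is over all perfect
matchings of `K_n`" [cite: Godsil1993, Ch. 7 §1].  The sign of the matching permutation is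
`(−1)^{cr(M)}`, `cr(M)` the number of CROSSING pairs of edges `{a < b}`, `{c < d}` with
`a < c < b < d` (the word `y_1 y_2 ⋯` with each pair increasing and pairs sorted by first letter is
reached from the sorted word by transpositions whose parity is the crossing number; standard, e.g.
"`sgn(μ) := (−1)^{#(crossings of μ)}`" in the overlapping-Pfaffian literature following
[cite: Knuth1996Pfaffians, §0–§1]) — this file takes the crossing form as the DEFINITION
(`pfaffian`, `crossings`) and proves from it the classical **row expansion**

  `pf A = Σ_{j=2}^{2n} (−1)^{j} a_{1j} · pf A_{1̂ĵ}`

— "Pfaffians can also be defined recursively … `f[x_1…x_{2n}] = Σ_{j=2}^{2n} f[x_1x_j]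
f[x_{j+1}…x_{2n}x_2…x_{j−1}]` (0.5).  This recurrence (see Jacobi) …"
[cite: Knuth1996Pfaffians, §0 eq. (0.5)] (the cyclic word `x_{j+1}…x_{2n}x_2…x_{j−1}` is a
rearrangement of `x_2…x̂_j…x_{2n}` of parity `(j−2)(2n−j) ≡ j (mod 2)`, so in the sorted order the
`j`-th term carries `(−1)^{j} = (−1)^{#{v : 1 < v < j}}`, the form proved here along the least
vertex of any finite linear order; Godsil derives the same row expansion from Halton's identity
`pf A · pf A[ij,ij] = −det A[i,j]` [cite: Godsil1993, Ch. 7 §3 (Lemma 3.2 and the closing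
paragraph)]); the plus-sign counterpart is the hafnian expansion of `HafnianExpansion.lean`
[cite: Caianiello1973, Ch. 1 §3 eq. (1.5) with §7 eq. (1.29)].  Hence the crossing definition
agrees with the textbook Pfaffian (same recursion (0.5), same base `f[ε] = 1`), which the checks
`pfaffian_fin_two` / **`pfaffian_fin_four`** (`= a₀₁a₂₃ − a₀₂a₁₃ + a₀₃a₁₂`: Knuth's (0.2)
`f[wxyz] = f[wx]f[yz] − f[wy]f[xz] + f[wz]f[xy]`, Godsil's display (1) `b₁₂b₃₄ − b₁₃b₂₄ + b₁₄b₂₃`)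
and **`det_fin_four_eq_pfaffian_sq`** (Cayley's `det A = (pf A)²` [cite: Godsil1993, Ch. 7 Thm 2.3]
for the generic skew-symmetric `4 × 4` matrix, Godsil's (1)) confirm on the printed examples.

(pub-qadeq lane context, CLAIMS row E-23 — the 56-qubit Fermi–Hubbard quench whose status cell
records "additive-error Pfaffian estimators for the NONINTERACTING quench incl. high-weight Wilson
observables": for free-fermion (matchgate / fermionic-linear-optics) dynamics every Majorana
correlator and output probability is a Pfaffian of a submatrix of the covariance matrix (Wick's
theorem), the fermionic counterpart of "GBS probabilities are hafnians" (rows E-11…E-15,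
`Hafnian.lean`, `HafnianGeneratingFunction.lean`).  Mathlib has no Pfaffian; the tree's Pfaffian is
`Literature.LinearAlgebra.Matrix.pfaffian` (recursive definition on `Fin n`, with Cayley's theorem
`Literature.LinearAlgebra.Matrix.det_eq_pfaffian_sq`); this file supplies the perfect-matching form
on a general finite linear order next to `hafnian`, its row expansion proved from the matching side,
and the proof that the two forms agree (ERRATUM, v2: v1 of this docstring said "nor the tree had
the matrix Pfaffian", which was wrong — the files listed above predate it).  HONEST FRAMING: instance-level
adjudication of specific advantage claims; no claim about BQP vs BPP or the summit — this file is
classical combinatorics and says nothing about any experiment, fermionic state or estimator.)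

## Contents (all proved, 0 named facts)

* `crossings τ` — the number of crossing pairs of matched edges of `τ ∈ perfectMatchings W`;
  `pfaffian A = Σ_τ (−1)^{crossings τ} ∏_{v < τ v} A v (τ v)` [cite: Knuth1996Pfaffians, §0 eq. (0.1)/(0.3)].
* `crossings_eq_crossings_restrict_add` — deleting the pair `{a, τ a}` of the least vertex `a`
  removes exactly the crossings with that pair; `neg_one_pow_card_crossing_eq` — their number has
  the parity of `#{v : a < v < τ a}` (the vertices under the arc `{a, τa}` are matched among
  themselves in pairs, or across the arc).
* **`pfaffian_eq_sum_mul_pfaffian_minor_of_forall_le`** — the row expansion along the least vertex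
  `a`: `pf A = Σ_{b ≠ a} (−1)^{#{v : a < v < b}} · A a b · pf (minor A a b)`
  [cite: Knuth1996Pfaffians, §0 eq. (0.5)] [cite: Godsil1993, Ch. 7 §3];
  `pfaffian_fin_eq_sum_row_zero` — on `Fin (m+1)`: `pf A = Σ_{j ≠ 0} (−1)^{(j−1)} A 0 j · pf A_{0̂ĵ}`.
* `pfaffian_of_isEmpty` (`pf` of the `0×0` matrix is `1`, "`f[ε] = 1`"), `pfaffian_of_card_two`,
  `pfaffian_fin_two` (`= a₀₁`), `pfaffian_fin_four` (`= a₀₁a₂₃ − a₀₂a₁₃ + a₀₃a₁₂`,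
  [cite: Knuth1996Pfaffians, §0 eq. (0.2)]), `det_fin_four_eq_pfaffian_sq` (Cayley for `n = 4`,
  [cite: Godsil1993, Ch. 7 §1 eq. (1) and Thm 2.3]).
* (v2) `perfectMatchings_eq_empty_of_odd` / `pfaffian_eq_zero_of_odd` ("identically zero when `n`
  is odd" [cite: Godsil1993, Ch. 7 (introduction)]); `crossings_permCongr` /
  `pfaffian_submatrix_equiv` (invariance under an order-preserving re-indexing);
  **`pfaffian_eq_matrixPfaffian`** — on `Fin n` the perfect-matching Pfaffian EQUALS the tree's
  recursively defined `Literature.LinearAlgebra.Matrix.pfaffian` (same base cases, same first-row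
  recursion (0.5) = Kustin–Ulrich (1.18); the minors are identified along the increasing bijection
  `Fin n ≃ {v ≠ 0, j+1}`, `pfaffian_minor_zero_succ`) [cite: Knuth1996Pfaffians, §0 eq. (0.5)]
  [cite: KustinUlrich1992, §1 (1.18)]; `matrixPfaffian_eq_sum_perfectMatchings` (the agreement "with
  the classical sum over perfect matchings" asserted in the tree file's docstring, now a theorem);
  **`det_eq_pfaffian_sq`** — Cayley's theorem `det A = (pf A)²` for alternating `A` (`Aᵀ = −A`, zero
  diagonal) on ANY finite linear order, transported from the tree's
  `Literature.LinearAlgebra.Matrix.det_eq_pfaffian_sq` [cite: Godsil1993, Ch. 7 Thm 2.3]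
  [cite: Cayley1849, pp. 93–96].

Not covered: `pf(BABᵀ) = det(B) pf(A)` (the tree's `PfaffianCongruence.lean` has it for the
recursive form; transport as for Cayley if needed), Knuth's overlapping-Pfaffian identities
(1.0)/(2.4)/(2.7), the determinant as a bipartite Pfaffian (§3 (3.0)–(3.2)), the crossing sign as
the permutation sign `s(α, μ)` stated as a lemma about `Equiv.Perm.sign` (witnessed here through
the recursion (0.5), the equality with the tree's Pfaffian and the `n ≤ 4` closed forms), Wick's
theorem / fermionic Gaussian states, and anything about cost.
-/

namespace Literature.Combinatorics.Enumerative

open Finset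

namespace Pfaffian

variable {W : Type*} [Fintype W] [DecidableEq W] [LinearOrder W] {R : Type*} [CommRing R]

/-! ### Crossings and the Pfaffian -/

/-- The indicator of "the matched edges at `x` and `y` cross, `x` first": `x < y < τ x < τ y`.
[cite: Knuth1996Pfaffians, §0 (sign of the matching permutation)] -/
def crossInd (τ : Equiv.Perm W) (x y : W) : ℕ := if x < y ∧ y < τ x ∧ τ x < τ y then 1 else 0

/-- The **crossing number** of a perfect matching `τ` (pairs of matched edges `{x < τ x}`,
`{y < τ y}` with `x < y < τ x < τ y`); `(−1)^{crossings τ}` is the sign of the matching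
permutation `y_1 y_2 ⋯ y_{2n}`. [cite: Knuth1996Pfaffians, §0 eq. (0.1) (the coefficient `s`)] -/
def crossings (τ : Equiv.Perm W) : ℕ := ∑ x, ∑ y, crossInd τ x y

/-- The **Pfaffian** of a matrix indexed by a finite linearly ordered type: the signed sum over
the perfect matchings of `K_W` of the products of the matched entries (smaller index first),
`pf A = Σ_M (−1)^{cr(M)} ∏_{{u<v} ∈ M} A u v`.  Only the entries `A u v`, `u < v`, are read (for a
skew-symmetric matrix this is the usual Pfaffian; cf. `hafnian`, the same sum without signs).
[cite: Knuth1996Pfaffians, §0 eqs. (0.1), (0.3)] [cite: Godsil1993, Ch. 7 §1 (definition of `pf A`)] -/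
def pfaffian (A : Matrix W W R) : R :=
  ∑ τ ∈ perfectMatchings W, (-1 : R) ^ crossings τ * ∏ v ∈ univ.filter (fun v => v < τ v), A v (τ v)

/-- "`f[ε] = 1`": the Pfaffian of the `0 × 0` matrix is `1` (the empty matching, no crossings).
[cite: Knuth1996Pfaffians, §0 eq. (0.5) (base of the recursion)] -/
theorem pfaffian_of_isEmpty [IsEmpty W] (A : Matrix W W R) : pfaffian A = 1 := by
  unfold pfaffian
  have hpm : perfectMatchings W = {1} := by
    ext τ
    simp only [mem_perfectMatchings, Finset.mem_singleton]
    exact ⟨fun _ => Subsingleton.elim _ _, fun _ => ⟨fun v => isEmptyElim v, fun v => isEmptyElim v⟩⟩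
  rw [hpm, Finset.sum_singleton]
  simp [crossings]

/-! ### Plumbing for the restriction / extension bijection of `HafnianExpansion` -/

section Bijection

open HafnianExpansion

variable {a b : W}

omit [Fintype W] [DecidableEq W] [LinearOrder W] in
/-- `restrict τ` acts as `τ` on underlying vertices. [cite: BarvinokDA2017, §4.3 (proof of (4.3.1))] -/
private theorem restrict_coe (τ : Equiv.Perm W) (hτ : ∀ v, τ (τ v) = v) (hab : τ a = b)
    (u : Compl2 a b) : ((restrict τ hτ hab u : Compl2 a b) : W) = τ u := rfl

omit [Fintype W] [LinearOrder W] in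
/-- `extend a b σ a = b`. [cite: BarvinokDA2017, §4.3 (proof of (4.3.1))] -/
private theorem extend_left (σ : Equiv.Perm (Compl2 a b)) : extend a b σ a = b := by
  rw [extend, Equiv.Perm.mul_apply,
    Equiv.Perm.ofSubtype_apply_of_not_mem σ (show ¬(a ≠ a ∧ a ≠ b) by simp),
    Equiv.swap_apply_left]

omit [Fintype W] [LinearOrder W] in
/-- `extend a b σ b = a`. [cite: BarvinokDA2017, §4.3 (proof of (4.3.1))] -/
private theorem extend_right (σ : Equiv.Perm (Compl2 a b)) : extend a b σ b = a := by
  rw [extend, Equiv.Perm.mul_apply,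
    Equiv.Perm.ofSubtype_apply_of_not_mem σ (show ¬(b ≠ a ∧ b ≠ b) by simp),
    Equiv.swap_apply_right]

omit [Fintype W] [LinearOrder W] in
/-- Off `{a, b}`, `extend a b σ` acts as `σ`. [cite: BarvinokDA2017, §4.3 (proof of (4.3.1))] -/
private theorem extend_of_ne (σ : Equiv.Perm (Compl2 a b)) {v : W} (hv : v ≠ a ∧ v ≠ b) :
    extend a b σ v = ((σ ⟨v, hv⟩ : Compl2 a b) : W) := by
  rw [extend, Equiv.Perm.mul_apply, Equiv.Perm.ofSubtype_apply_of_mem σ hv]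
  exact Equiv.swap_apply_of_ne_of_ne (σ ⟨v, hv⟩).2.1 (σ ⟨v, hv⟩).2.2

omit [LinearOrder W] in
/-- `restrict ∘ extend = id`. [cite: BarvinokDA2017, §4.3 (proof of (4.3.1))] -/
private theorem restrict_extend' (hab : a ≠ b) {σ : Equiv.Perm (Compl2 a b)}
    (hσ : σ ∈ perfectMatchings (Compl2 a b)) :
    restrict (extend a b σ) (mem_perfectMatchings.mp (extend_mem hab hσ)).1
      (extend_left σ) = σ := by
  refine Equiv.ext fun u => Subtype.ext ?_
  rw [restrict_coe, extend_of_ne σ u.2]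

omit [LinearOrder W] in
/-- `extend ∘ restrict = id`. [cite: BarvinokDA2017, §4.3 (proof of (4.3.1))] -/
private theorem extend_restrict' {τ : Equiv.Perm W} (hτ : τ ∈ perfectMatchings W) (hab : τ a = b) :
    extend a b (restrict τ (mem_perfectMatchings.mp hτ).1 hab) = τ := by
  have hne : a ≠ b := fun h => (mem_perfectMatchings.mp hτ).2 a (by rw [hab, h])
  have hba : τ b = a := by rw [← hab, (mem_perfectMatchings.mp hτ).1]
  refine Equiv.ext fun v => ?_
  by_cases hva : v = a
  · rw [hva, extend_left, hab]
  by_cases hvb : v = b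
  · rw [hvb, extend_right, hba]
  rw [extend_of_ne _ ⟨hva, hvb⟩, restrict_coe]

end Bijection

/-! ### Crossings under deletion of the pair of the least vertex -/

section Crossings

open HafnianExpansion

variable {a b : W}

omit [Fintype W] [DecidableEq W] in
/-- With `a` the least vertex and `τ a = b`: no crossing pair has `b` as its first edge-start, none
has `a` or `b` as its second. [cite: Knuth1996Pfaffians, §0 (the recursion (0.5): the pair `{x_1, x_j}`)] -/
private theorem crossInd_eq_zero_of_mem {τ : Equiv.Perm W} (hab : τ a = b) (hba : τ b = a)
    (ha : ∀ v, a ≤ v) (x y : W) (h : x = b ∨ y = a ∨ y = b) (hxa : x ≠ a) : crossInd τ x y = 0 := by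
  unfold crossInd
  rw [if_neg]
  rintro ⟨h1, h2, h3⟩
  rcases h with rfl | rfl | rfl
  · rw [hba] at h2
    exact absurd (lt_trans h1 h2) (not_lt.mpr (ha x))
  · exact absurd h1 (not_lt.mpr (ha x))
  · rw [hba] at h3
    exact absurd h3 (not_lt.mpr (ha _))

/-- **Deleting the pair of the least vertex.**  For a perfect matching `τ` with `τ a = b`, `a` the
least vertex, the crossings of `τ` are those of its restriction to `W ∖ {a, b}` plus the crossings
with the edge `{a, b}` itself, i.e. the vertices `c` with `a < c < b < τ c`.
[cite: Knuth1996Pfaffians, §0 eq. (0.5) (sign bookkeeping of the recursion)] -/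
theorem crossings_eq_crossings_restrict_add {τ : Equiv.Perm W} (hτ : τ ∈ perfectMatchings W)
    (hab : τ a = b) (ha : ∀ v, a ≤ v) :
    crossings τ = crossings (restrict τ (mem_perfectMatchings.mp hτ).1 hab) +
      (univ.filter fun c => a < c ∧ c < b ∧ b < τ c).card := by
  classical
  have hinv := (mem_perfectMatchings.mp hτ).1
  have hne : a ≠ b := fun h => (mem_perfectMatchings.mp hτ).2 a (by rw [hab, h])
  have hba : τ b = a := by rw [← hab, hinv]
  unfold crossings
  -- split off the row `x = a`
  rw [← Finset.add_sum_erase univ _ (Finset.mem_univ a), add_comm]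
  congr 1
  · -- rows `x ≠ a`: only `x, y ∉ {a, b}` contribute, and they are the crossings of the restriction
    have hmem : ∀ x, x ∈ (univ.erase a).erase b ↔ x ≠ a ∧ x ≠ b := by
      intro x; simp only [Finset.mem_erase, Finset.mem_univ, and_true]; tauto
    -- drop the row `x = b` (all zero) and, in each remaining row, the columns `y = a`, `y = b`
    have hrowb : ∑ y, crossInd τ b y = 0 :=
      Finset.sum_eq_zero fun y _ => crossInd_eq_zero_of_mem hab hba ha b y (Or.inl rfl) hne.symm
    rw [← Finset.add_sum_erase (univ.erase a) _ (Finset.mem_erase.mpr ⟨hne.symm, Finset.mem_univ b⟩),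
      hrowb, zero_add]
    have hcol : ∀ x ∈ (univ.erase a).erase b, ∑ y, crossInd τ x y =
        ∑ y ∈ (univ.erase a).erase b, crossInd τ x y := by
      intro x hx
      have hxa : x ≠ a := ((hmem x).mp hx).1
      rw [← Finset.add_sum_erase univ _ (Finset.mem_univ a),
        crossInd_eq_zero_of_mem hab hba ha x a (Or.inr (Or.inl rfl)) hxa, zero_add,
        ← Finset.add_sum_erase (univ.erase a) _ (Finset.mem_erase.mpr ⟨hne.symm, Finset.mem_univ b⟩),
        crossInd_eq_zero_of_mem hab hba ha x b (Or.inr (Or.inr rfl)) hxa, zero_add]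
    rw [Finset.sum_congr rfl hcol]
    rw [Finset.sum_subtype (p := fun v => v ≠ a ∧ v ≠ b) (F := inferInstance) _ hmem]
    refine Finset.sum_congr rfl fun u _ => ?_
    rw [Finset.sum_subtype (p := fun v => v ≠ a ∧ v ≠ b) (F := inferInstance) _ hmem]
    refine Finset.sum_congr rfl fun u' _ => ?_
    -- the indicator is the same on the subtype (induced order, `restrict τ u = τ u`)
    unfold crossInd
    rfl
  · -- the row `x = a`: `a < y < τ a = b < τ y`
    rw [Finset.card_eq_sum_ones, Finset.sum_filter]
    refine Finset.sum_congr rfl fun y _ => ?_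
    unfold crossInd
    rw [hab]

/-- **Parity of the crossings with the deleted pair.**  With `a` least and `τ a = b`, every vertex
strictly between `a` and `b` is matched either to another such vertex (these come in pairs) or to
a vertex beyond `b` (a crossing with `{a,b}`); hence
`(−1)^{#{c : a < c < b < τ c}} = (−1)^{#{v : a < v < b}}`.
[cite: Knuth1996Pfaffians, §0 eq. (0.5) ("each of those permutations is even": the sign `(−1)^{j}`)] -/
theorem neg_one_pow_card_crossing_eq {τ : Equiv.Perm W} (hτ : τ ∈ perfectMatchings W)
    (hab : τ a = b) (ha : ∀ v, a ≤ v) :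
    (-1 : R) ^ (univ.filter fun c => a < c ∧ c < b ∧ b < τ c).card =
      (-1 : R) ^ (univ.filter fun v => a < v ∧ v < b).card := by
  classical
  obtain ⟨hinv, hfix⟩ := mem_perfectMatchings.mp hτ
  have hba : τ b = a := by rw [← hab, hinv]
  -- the interval `I = {v : a < v < b}` splits into `J = {v ∈ I : τ v ∈ I}` and the crossing set
  set I : Finset W := univ.filter fun v => a < v ∧ v < b with hI
  set J : Finset W := univ.filter fun v => (a < v ∧ v < b) ∧ (a < τ v ∧ τ v < b) with hJ
  set C : Finset W := univ.filter fun c => a < c ∧ c < b ∧ b < τ c with hC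
  have hsplit : I = J ∪ C := by
    ext v
    simp only [hI, hJ, hC, Finset.mem_filter, Finset.mem_univ, true_and, Finset.mem_union]
    constructor
    · rintro ⟨h1, h2⟩
      by_cases h3 : τ v < b
      · refine Or.inl ⟨⟨h1, h2⟩, ?_, h3⟩
        rcases (ha (τ v)).eq_or_lt with h4 | h4
        · -- `τ v = a` would force `v = b`
          have hv : v = b := by rw [← hinv v, ← h4, hab]
          exact absurd hv (ne_of_lt h2)
        · exact h4
      · rcases (not_lt.mp h3).eq_or_lt with h4 | h4
        · -- `τ v = b` would force `v = a`
          have hv : v = a := by rw [← hinv v, ← h4, hba]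
          exact absurd hv (ne_of_gt h1)
        · exact Or.inr ⟨h1, h2, h4⟩
    · rintro (⟨⟨h1, h2⟩, -⟩ | ⟨h1, h2, -⟩) <;> exact ⟨h1, h2⟩
  have hdisj : Disjoint J C := by
    rw [Finset.disjoint_left]
    intro v hvJ hvC
    simp only [hJ, hC, Finset.mem_filter, Finset.mem_univ, true_and] at hvJ hvC
    exact absurd (lt_trans hvJ.2.2 hvC.2.2) (lt_irrefl _)
  -- `J` is `τ`-stable without fixed points, hence of even size
  have hJeven : Even J.card := by
    set J₁ : Finset W := J.filter fun v => v < τ v with hJ₁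
    set J₂ : Finset W := J.filter fun v => τ v < v with hJ₂
    have hJsplit : J = J₁ ∪ J₂ := by
      ext v
      simp only [hJ₁, hJ₂, Finset.mem_filter, Finset.mem_union]
      constructor
      · intro hv
        rcases lt_or_gt_of_ne (hfix v).symm with h | h
        · exact Or.inl ⟨hv, h⟩
        · exact Or.inr ⟨hv, h⟩
      · rintro (⟨hv, -⟩ | ⟨hv, -⟩) <;> exact hv
    have hJdisj : Disjoint J₁ J₂ := by
      rw [Finset.disjoint_left]
      intro v h1 h2
      simp only [hJ₁, hJ₂, Finset.mem_filter] at h1 h2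
      exact absurd (lt_trans h1.2 h2.2) (lt_irrefl _)
    have hcard : J₁.card = J₂.card := by
      refine Finset.card_bij (fun v _ => τ v) ?_ ?_ ?_
      · intro v hv
        simp only [hJ₁, hJ₂, hJ, Finset.mem_filter, Finset.mem_univ, true_and] at hv ⊢
        obtain ⟨⟨hvI, hτvI⟩, hlt⟩ := hv
        refine ⟨⟨hτvI, ?_⟩, ?_⟩
        · rw [hinv]; exact hvI
        · rw [hinv]; exact hlt
      · intro v _ v' _ h
        simpa [hinv] using congrArg τ h
      · intro w hw
        simp only [hJ₂, hJ, Finset.mem_filter, Finset.mem_univ, true_and] at hw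
        obtain ⟨⟨hwI, hτwI⟩, hlt⟩ := hw
        refine ⟨τ w, ?_, hinv w⟩
        simp only [hJ₁, hJ, Finset.mem_filter, Finset.mem_univ, true_and]
        refine ⟨⟨hτwI, ?_⟩, ?_⟩
        · rw [hinv]; exact hwI
        · rw [hinv]; exact hlt
    rw [hJsplit, Finset.card_union_of_disjoint hJdisj, hcard]
    exact ⟨J₂.card, rfl⟩
  rw [hsplit, Finset.card_union_of_disjoint hdisj, pow_add, hJeven.neg_one_pow, one_mul]

end Crossings

/-! ### The row expansion along the least vertex -/

section Expansion

open HafnianExpansion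

/-- **Row expansion of the Pfaffian along the least vertex** (Jacobi's recursion, Knuth's (0.5);
Godsil Ch. 7 §3): for `a` the least element of `W`,

  `pf A = Σ_{b ≠ a} (−1)^{#{v : a < v < b}} · A a b · pf (A with rows/columns a, b deleted)`.

[cite: Knuth1996Pfaffians, §0 eq. (0.5)] [cite: Godsil1993, Ch. 7 §3 (row expansions)] -/
theorem pfaffian_eq_sum_mul_pfaffian_minor_of_forall_le (A : Matrix W W R) (a : W)
    (ha : ∀ v, a ≤ v) :
    pfaffian A = ∑ b ∈ univ.erase a,
      (-1 : R) ^ (univ.filter fun v => a < v ∧ v < b).card * A a b * pfaffian (minor A a b) := by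
  classical
  unfold pfaffian
  rw [← Finset.sum_fiberwise_of_maps_to (s := perfectMatchings W) (t := univ.erase a)
    (g := fun τ => τ a)
    (fun τ hτ => Finset.mem_erase.mpr ⟨(mem_perfectMatchings.mp hτ).2 a, Finset.mem_univ _⟩)]
  refine Finset.sum_congr rfl fun b hb => ?_
  have hba : b ≠ a := (Finset.mem_erase.mp hb).1
  have hablt : a < b := lt_of_le_of_ne (ha b) hba.symm
  rw [Finset.mul_sum]
  refine Finset.sum_bij'
    (fun τ hτ => restrict τ (mem_perfectMatchings.mp (Finset.mem_filter.mp hτ).1).1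
      (Finset.mem_filter.mp hτ).2)
    (fun σ _ => extend a b σ) ?_ ?_ ?_ ?_ ?_
  · intro τ hτ
    exact restrict_mem (Finset.mem_filter.mp hτ).1 _
  · intro σ hσ
    exact Finset.mem_filter.mpr ⟨extend_mem hba.symm hσ, extend_left σ⟩
  · intro τ hτ
    exact extend_restrict' (Finset.mem_filter.mp hτ).1 (Finset.mem_filter.mp hτ).2
  · intro σ hσ
    exact restrict_extend' hba.symm hσ
  · intro τ hτ
    have hτ' := (Finset.mem_filter.mp hτ).1
    have hab := (Finset.mem_filter.mp hτ).2
    rw [prod_eq_pairEntry_mul_prod_restrict A hτ' hab, pairEntry_of_lt hablt,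
      crossings_eq_crossings_restrict_add hτ' hab ha, pow_add,
      neg_one_pow_card_crossing_eq (R := R) hτ' hab ha]
    ring

/-- The `Fin`-indexed reading: for `A` on `Fin (m + 1)`,
`pf A = Σ_{j ≠ 0} (−1)^{j − 1} A 0 j · pf A_{0̂ĵ}` (0-indexed; with indices from `1` the sign of the
`j`-th term is `(−1)^{j}`, the parity of Knuth's cyclic rearrangement in (0.5)).
[cite: Knuth1996Pfaffians, §0 eq. (0.5)] -/
theorem pfaffian_fin_eq_sum_row_zero {m : ℕ} (A : Matrix (Fin (m + 1)) (Fin (m + 1)) R) :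
    pfaffian A = ∑ j ∈ (univ : Finset (Fin (m + 1))).erase 0,
      (-1 : R) ^ (j.val - 1) * A 0 j * pfaffian (minor A 0 j) := by
  rw [pfaffian_eq_sum_mul_pfaffian_minor_of_forall_le A 0 fun v => Fin.zero_le v]
  refine Finset.sum_congr rfl fun j _ => ?_
  congr 2
  have : (univ.filter fun v : Fin (m + 1) => 0 < v ∧ v < j) = Finset.Ioo 0 j := by
    ext v; simp
  rw [this, Fin.card_Ioo]
  simp

end Expansion

/-! ### Small cases -/

section Small

open HafnianExpansion

/-- A two-element vertex set `{c < d}`: `pf A = A c d` (one matching, no crossing).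
[cite: Knuth1996Pfaffians, §0 eq. (0.5) (the case `n = 1`: `f[x_1x_2]`)] -/
theorem pfaffian_of_card_two (A : Matrix W W R) {c d : W} (hcd : c < d)
    (huniv : (univ : Finset W) = {c, d}) : pfaffian A = A c d := by
  classical
  have hmin : ∀ v, c ≤ v := by
    intro v
    have hv : v ∈ ({c, d} : Finset W) := huniv ▸ Finset.mem_univ v
    rcases Finset.mem_insert.mp hv with rfl | hv
    · exact le_rfl
    · rw [Finset.mem_singleton.mp hv]; exact hcd.le
  rw [pfaffian_eq_sum_mul_pfaffian_minor_of_forall_le A c hmin]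
  have herase : (univ : Finset W).erase c = {d} := by
    rw [huniv, Finset.erase_insert]
    simp [hcd.ne]
  rw [herase, Finset.sum_singleton]
  have hempty : (univ.filter fun v : W => c < v ∧ v < d) = ∅ := by
    ext v
    simp only [Finset.mem_filter, Finset.mem_univ, true_and, Finset.notMem_empty, iff_false,
      not_and, not_lt]
    intro hcv
    have hv : v ∈ ({c, d} : Finset W) := huniv ▸ Finset.mem_univ v
    rcases Finset.mem_insert.mp hv with rfl | hv
    · exact absurd hcv (lt_irrefl _)
    · rw [Finset.mem_singleton.mp hv]
  haveI : IsEmpty (Compl2 c d) := ⟨fun x => by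
    have hx : (x : W) ∈ ({c, d} : Finset W) := huniv ▸ Finset.mem_univ (x : W)
    rcases Finset.mem_insert.mp hx with h | h
    · exact x.2.1 h
    · exact x.2.2 (Finset.mem_singleton.mp h)⟩
  rw [hempty, Finset.card_empty, pow_zero, one_mul, pfaffian_of_isEmpty, mul_one]

/-- `pf` of a `2 × 2` matrix is its upper-right entry: `f[x_1x_2] = f[x_1x_2]`.
[cite: Knuth1996Pfaffians, §0 eq. (0.5)] -/
theorem pfaffian_fin_two (A : Matrix (Fin 2) (Fin 2) R) : pfaffian A = A 0 1 :=
  pfaffian_of_card_two A (by decide) (by decide)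

/-- **The `4 × 4` Pfaffian**: `pf A = a₀₁a₂₃ − a₀₂a₁₃ + a₀₃a₁₂` — Knuth's
"`f[wxyz] = f[wx]f[yz] − f[wy]f[xz] + f[wz]f[xy]`" (0.2), Godsil's `b₁₂b₃₄ − b₁₃b₂₄ + b₁₄b₂₃`.
[cite: Knuth1996Pfaffians, §0 eq. (0.2)] [cite: Godsil1993, Ch. 7 §1 eq. (1)] -/
theorem pfaffian_fin_four (A : Matrix (Fin 4) (Fin 4) R) :
    pfaffian A = A 0 1 * A 2 3 - A 0 2 * A 1 3 + A 0 3 * A 1 2 := by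
  rw [pfaffian_fin_eq_sum_row_zero]
  -- the three minors are `2 × 2` Pfaffians on the remaining two vertices
  have h1 : pfaffian (minor A 0 1) = A 2 3 :=
    pfaffian_of_card_two (minor A 0 1) (c := ⟨2, by decide⟩) (d := ⟨3, by decide⟩) (by decide)
      (by decide)
  have h2 : pfaffian (minor A 0 2) = A 1 3 :=
    pfaffian_of_card_two (minor A 0 2) (c := ⟨1, by decide⟩) (d := ⟨3, by decide⟩) (by decide)
      (by decide)
  have h3 : pfaffian (minor A 0 3) = A 1 2 :=
    pfaffian_of_card_two (minor A 0 3) (c := ⟨1, by decide⟩) (d := ⟨2, by decide⟩) (by decide)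
      (by decide)
  have huniv : (univ : Finset (Fin 4)).erase 0 = {1, 2, 3} := by decide
  rw [huniv, Finset.sum_insert (by decide), Finset.sum_insert (by decide), Finset.sum_singleton,
    h1, h2, h3]
  simp
  ring

/-- **Cayley's theorem for `n = 4`**: for the generic skew-symmetric `4 × 4` matrix,
`det A = (pf A)²` — Godsil's display (1), `det B = (b₁₂b₃₄ − b₁₃b₂₄ + b₁₄b₂₃)²`.
[cite: Godsil1993, Ch. 7 §1 eq. (1) and Thm 2.3] -/
theorem det_fin_four_eq_pfaffian_sq (a b c d e f : R) :
    (!![0, a, b, c; -a, 0, d, e; -b, -d, 0, f; -c, -e, -f, 0] : Matrix (Fin 4) (Fin 4) R).det =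
      (pfaffian (!![0, a, b, c; -a, 0, d, e; -b, -d, 0, f; -c, -e, -f, 0] :
        Matrix (Fin 4) (Fin 4) R)) ^ 2 := by
  rw [pfaffian_fin_four, Matrix.det_succ_row_zero]
  simp [Fin.sum_univ_succ, Matrix.det_fin_three, Matrix.submatrix_apply, Fin.succAbove]
  ring

end Small

/-! ### Odd order, re-indexing, and agreement with the tree's recursively defined Pfaffian (v2) -/

section Bridge

open HafnianExpansion
open scoped Matrix

/-- A vertex set of odd size has no perfect matching (each matching consists of `|W|/2` pairs),
so its Pfaffian — an empty sum — vanishes: "It is identically zero when `n` is odd."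
[cite: Godsil1993, Ch. 7 (introduction)] -/
theorem perfectMatchings_eq_empty_of_odd (h : Odd (Fintype.card W)) :
    perfectMatchings W = ∅ := by
  classical
  refine Finset.eq_empty_of_forall_notMem fun τ hτ => ?_
  have hm := mem_perfectMatchings.mp hτ
  have h2 := two_mul_card_filter_lt_add_card_fixed hm.1
  rw [Finset.card_eq_zero.mpr (Finset.filter_eq_empty_iff.mpr fun v _ => hm.2 v), add_zero] at h2
  exact (Nat.not_even_iff_odd.mpr h) ⟨_, by rw [← h2, two_mul]⟩

/-- `pf A = 0` for a vertex set of odd size. [cite: Godsil1993, Ch. 7 (introduction: "It is identically zero when n is odd")] -/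
theorem pfaffian_eq_zero_of_odd (A : Matrix W W R) (h : Odd (Fintype.card W)) : pfaffian A = 0 := by
  unfold pfaffian
  rw [perfectMatchings_eq_empty_of_odd h, Finset.sum_empty]

omit [LinearOrder W] in
/-- Conjugating by a bijection preserves "fixed-point-free involution" (the perfect matchings of
`W'` and `W` correspond under any bijection). [cite: Knuth1996Pfaffians, §0 eq. (0.1)] -/
private theorem permCongr_mem_perfectMatchings_iff' {W' : Type*}
    [Fintype W'] [DecidableEq W'] (e : W' ≃ W) (τ : Equiv.Perm W') :
    e.permCongr τ ∈ perfectMatchings W ↔ τ ∈ perfectMatchings W' := by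
  simp only [mem_perfectMatchings, Equiv.permCongr_apply, Equiv.symm_apply_apply]
  constructor
  · rintro ⟨h1, h2⟩
    refine ⟨fun v => ?_, fun v => ?_⟩
    · exact e.injective (by simpa using h1 (e v))
    · intro h
      exact h2 (e v) (by simpa using congrArg e h)
  · rintro ⟨h1, h2⟩
    refine ⟨fun v => by simp [h1], fun v => ?_⟩
    intro h
    apply h2 (e.symm v)
    exact e.injective (by simpa using h)

omit [DecidableEq W] in
/-- The crossing number is invariant under an order-preserving re-indexing of the vertices.
[cite: Knuth1996Pfaffians, §0 (the sign `s` depends only on the relative order of the letters)] -/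
theorem crossings_permCongr {W' : Type*} [Fintype W'] [DecidableEq W'] [LinearOrder W']
    (e : W' ≃ W) (he : StrictMono e) (τ : Equiv.Perm W') :
    crossings (e.permCongr τ) = crossings τ := by
  unfold crossings
  rw [← e.sum_comp]
  refine Finset.sum_congr rfl fun x _ => ?_
  rw [← e.sum_comp]
  refine Finset.sum_congr rfl fun y _ => ?_
  unfold crossInd
  simp only [Equiv.permCongr_apply, Equiv.symm_apply_apply, he.lt_iff_lt]

/-- **The Pfaffian does not change under an order-preserving simultaneous re-indexing of rows and
columns** (`pf(A ∘ (e × e)) = pf A` for a strictly monotone bijection `e`; the matchings, their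
crossing numbers and the matched products correspond). [cite: Knuth1996Pfaffians, §0 eq. (0.1)/(0.3)] -/
theorem pfaffian_submatrix_equiv {W' : Type*} [Fintype W'] [DecidableEq W'] [LinearOrder W']
    (e : W' ≃ W) (he : StrictMono e) (A : Matrix W W R) :
    pfaffian (A.submatrix e e) = pfaffian A := by
  unfold pfaffian
  refine Finset.sum_equiv e.permCongr
    (fun τ => (permCongr_mem_perfectMatchings_iff' e τ).symm)
    (fun τ _ => ?_)
  rw [crossings_permCongr e he τ]
  congr 1
  refine Finset.prod_equiv e (fun v => ?_) (fun v _ => ?_)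
  · simp only [Finset.mem_filter, Finset.mem_univ, true_and, Equiv.permCongr_apply,
      Equiv.symm_apply_apply]
    exact (he.lt_iff_lt).symm
  · simp [Matrix.submatrix_apply]

/-- The increasing bijection from `Fin n` onto the vertices of `Fin (n+2)` other than `0` and
`j+1` (`i ↦ (j.succAbove i).succ`), identifying the tree's `pfMinor A j` with this file's
`minor A 0 j.succ`. [cite: KustinUlrich1992, §1 (1.18) (the minors of the Laplace expansion)] -/
theorem exists_strictMono_equiv_compl2 {n : ℕ} (j : Fin (n + 1)) :
    ∃ e : Fin n ≃ Compl2 (0 : Fin (n + 2)) j.succ,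
      StrictMono e ∧ ∀ i, ((e i : Compl2 (0 : Fin (n + 2)) j.succ) : Fin (n + 2)) = (j.succAbove i).succ := by
  let f : Fin n → Compl2 (0 : Fin (n + 2)) j.succ := fun i =>
    ⟨(j.succAbove i).succ, Fin.succ_ne_zero _, fun h => Fin.succAbove_ne j i (Fin.succ_injective _ h)⟩
  have hf : StrictMono f := fun a b hab =>
    show (j.succAbove a).succ < (j.succAbove b).succ from
      Fin.strictMono_succ (Fin.strictMono_succAbove j hab)
  have hsurj : Function.Surjective f := by
    rintro ⟨v, hv0, hvj⟩
    obtain ⟨w, rfl⟩ := Fin.exists_succ_eq.mpr hv0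
    have hwj : w ≠ j := fun h => hvj (by rw [h])
    obtain ⟨i, rfl⟩ := Fin.exists_succAbove_eq hwj
    exact ⟨i, rfl⟩
  exact ⟨Equiv.ofBijective f ⟨hf.injective, hsurj⟩, hf, fun i => rfl⟩

/-- The minors agree: this file's `pf (minor A 0 (j+1))` (vertex set `{v : v ≠ 0, j+1}` with the
induced order) equals `pf` of the tree's re-indexed `pfMinor A j : Matrix (Fin n) (Fin n) R`.
[cite: KustinUlrich1992, §1 (1.18)] [cite: Knuth1996Pfaffians, §0 eq. (0.5)] -/
theorem pfaffian_minor_zero_succ {n : ℕ} (A : Matrix (Fin (n + 2)) (Fin (n + 2)) R)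
    (j : Fin (n + 1)) :
    pfaffian (minor A 0 j.succ) = pfaffian (Literature.LinearAlgebra.Matrix.pfMinor A j) := by
  obtain ⟨e, he, hval⟩ := exists_strictMono_equiv_compl2 (n := n) j
  rw [← pfaffian_submatrix_equiv e he (minor A 0 j.succ)]
  congr 1
  ext a b
  simp [Matrix.submatrix_apply, Literature.LinearAlgebra.Matrix.pfMinor_apply, hval]

/-- **The perfect-matching Pfaffian equals the recursively defined Pfaffian of the tree**
(`Literature.LinearAlgebra.Matrix.pfaffian`, Kustin–Ulrich's Laplace expansion along the first
row with `pf [[0,a],[-a,0]] = a`): both satisfy `f[ε] = 1`, vanish in odd size, and obey the same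
first-row recursion (0.5) — "Pfaffians can also be defined recursively".
[cite: Knuth1996Pfaffians, §0 eq. (0.5)] [cite: KustinUlrich1992, §1 p. 9 and (1.18)] -/
theorem pfaffian_eq_matrixPfaffian : ∀ {n : ℕ} (A : Matrix (Fin n) (Fin n) R),
    pfaffian A = Literature.LinearAlgebra.Matrix.pfaffian A
  | 0, A => by rw [pfaffian_of_isEmpty, Literature.LinearAlgebra.Matrix.pfaffian_fin_zero]
  | 1, A => by
    rw [Literature.LinearAlgebra.Matrix.pfaffian_fin_one]
    exact pfaffian_eq_zero_of_odd A (by simp)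
  | n + 2, A => by
    rw [pfaffian_fin_eq_sum_row_zero, Literature.LinearAlgebra.Matrix.pfaffian_fin_add_two]
    -- re-index the sum over `j ≠ 0` in `Fin (n+2)` by `j = succ j'`, `j' : Fin (n+1)`
    set f : Fin (n + 2) → R := fun j => (-1 : R) ^ (j.val - 1) * A 0 j * pfaffian (minor A 0 j)
      with hf
    have hsum : ∑ j ∈ (univ : Finset (Fin (n + 2))).erase 0, f j = ∑ j : Fin (n + 1), f j.succ := by
      have h := Finset.add_sum_erase (univ : Finset (Fin (n + 2))) f (Finset.mem_univ 0)
      rw [Fin.sum_univ_succ] at h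
      exact add_left_cancel h
    rw [hsum]
    refine Finset.sum_congr rfl fun j _ => ?_
    simp only [hf, Fin.val_succ, Nat.add_sub_cancel]
    rw [pfaffian_minor_zero_succ A j, pfaffian_eq_matrixPfaffian]

/-- The statement recorded (without proof) in the docstring of the tree's
`Literature.LinearAlgebra.Matrix.pfaffian`: the recursively defined Pfaffian "agrees with the
classical sum over perfect matchings". [cite: Knuth1996Pfaffians, §0 eqs. (0.1), (0.3), (0.5)] -/
theorem matrixPfaffian_eq_sum_perfectMatchings {n : ℕ} (A : Matrix (Fin n) (Fin n) R) :
    Literature.LinearAlgebra.Matrix.pfaffian A =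
      ∑ τ ∈ perfectMatchings (Fin n),
        (-1 : R) ^ crossings τ * ∏ v ∈ univ.filter (fun v => v < τ v), A v (τ v) :=
  (pfaffian_eq_matrixPfaffian A).symm

/-- **Cayley's theorem for the perfect-matching Pfaffian, any finite linear order**: for an
alternating matrix (`Aᵀ = −A`, zero diagonal) over any commutative ring, `det A = (pf A)²` —
transported from the tree's `Literature.LinearAlgebra.Matrix.det_eq_pfaffian_sq` (Cayley 1849;
Godsil Ch. 7 Thm 2.3) along the increasing bijection `Fin |W| ≃ W`.
[cite: Godsil1993, Ch. 7 Thm 2.3] [cite: Cayley1849, pp. 93–96] -/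
theorem det_eq_pfaffian_sq (A : Matrix W W R) (hA : Aᵀ = -A) (hd : ∀ i, A i i = 0) :
    A.det = pfaffian A ^ 2 := by
  let e := monoEquivOfFin W rfl
  have hsub : (A.submatrix e e)ᵀ = -A.submatrix e e := by
    rw [Matrix.transpose_submatrix, hA, Matrix.submatrix_neg]
    rfl
  rw [← Matrix.det_submatrix_equiv_self e.toEquiv A,
    ← pfaffian_submatrix_equiv e.toEquiv e.strictMono A]
  change (A.submatrix e e).det = pfaffian (A.submatrix e e) ^ 2
  rw [Literature.LinearAlgebra.Matrix.det_eq_pfaffian_sq _ hsub fun i => hd _,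
    pfaffian_eq_matrixPfaffian]

end Bridge

end Pfaffian

end Literature.Combinatorics.Enumerative
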